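import Literature.MathematicalPhysics.QuantumFieldTheory.Balaban1983to89.B13InverseDecayWeightedPairing
import Literature.MathematicalPhysics.QuantumFieldTheory.Balaban1983to89.B9Thm32SiteXBoundsY
import Literature.MathematicalPhysics.QuantumFieldTheory.Balaban1983to89.B13MatrixUnitBasisNumerals

/-!
# `Balaban1983to89.B13XinvCentreDecayOfUnitary` — T. Bałaban, *Propagators for lattice gauge theories in a background field*, Commun. Math. Phys. **99** (1985)
# 389–434 [Balaban1985BackgroundPropagators], (3.25) p. 394 («(Q′G′²Q′*)⁻¹»), Thm 3.2 (3.48) p. 398, Thm 3.11 p. 416 («the operators Δ′_a, G′, (Q′G′²Q′*)⁻¹ … are positive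
# definite»), Sect. B (3.66)–(3.70) pp. 403–404, with [4] = [Balaban1984PropagatorsII] Lemma 2.1 (2.61) p. 234, Prop 2.3 p. 238; [Balaban1988RG2Cluster] (2.5)–(2.7) pp. 12–13:
# ★★★ THE CENTRE DECAY OF PRINT's SECOND INVERSE `C(U₀) = (Q′G′²Q′*)⁻¹(U₀)` AT def-Y's v4 LETTER FOR EVERY UNITARY-VALUED BACKGROUND, MODULO ONE DISPLAYED DATUM —
# the entry decay of the un-inverted `X(U₀) = (Q′G′²Q′*)(U₀)` — with POSITIVITY SUPPLIED BY N06's THEOREM (dag-n06-w1 `B9Thm32SiteXBoundsY.trIP_XY_parSymY_ge`).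

statement-level bookkeeping (the dictionary between NODE 00's block-volume pairing `trIP (wB i)` and the weighted accretivity hypothesis of module 80) + one call of
module 80's Combes–Thomas theorem; kernel-checked; THEOREMS ONLY (no `def`, no `structure`, no instance, no notation); NOTHING of NODE 00's ∕ N06's is modified;
nothing here is a claim about the Yang–Mills mass gap; no node is discharged; count-neutral.

WHY THIS FILE (cell `pub-ymgap`, HUMAN RULING D-0062 ∕ D-0149, Track A node N10 = [B13]; seat `pub-ymgap-dag-n10-c` g15, INTENT-6 = module 81; census
`N10-RESIDUAL-CENSUS-v17.md` item 2; the LOCATED recipe of INBOX l.29493, steps (i)+(iii)+(iv) generic in module 80).  Width seat n10-w2's X⁻¹-junction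
(`B13OpsYPencilXQuad` §4 ∕ `B13InverseOperatorCoordinates.rawEntryLetters_toMatrix_XinvY_prodCfg_located`) displays TWO N06 inputs at the one real background
`U₀`: `IsUnit (X(U₀))` and a (3.48)-type decay of the matrix of `X(U₀)⁻¹`.  At the v4 letter `parSymY` the first IS dag-n06's `isUnit_XY_parSymY`; THIS FILE
derives the second from (a) n06-w1's LOWER BOUND `X(U) ≥ (4(d+1)+1)⁻²` in the block-volume pairing at EVERY `G`-valued background (`G ≤ U(N)`; no (3.35), no
smallness), read as the `wB`-weighted accretivity of the matrix of `X(U₀)` in the product basis (blocks × matrix units) — §1–§2 —, and (b) ONE displayed datum: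
the exponential entry decay of that matrix, `‖toMatrix B′ B′ (X(U₀)) p q‖ ≤ a·e^{−κ₀ d₁(loc p, loc q)}` (= the `u = 0` clause of the X-station's pencil letters, whose
G′ input is module 79 on the (3.35) class) — through module 80's `inverse_decay_of_expDecay_weighted` (§3).

WHAT THIS FILE PROVES (all `theorem`s; `𝔸 = M_N(ℂ)`, L²-operator norm of record; product basis `B′ = (δ_s ⊗ E_{ab})`).
* §1 `repr_piStd_apply` (`B′`-coordinates are the entries `g s a b`), `coe_repr_piStd_of` (the field with prescribed coordinates), `re_star_mul_self`.
* §2 ★ `weighted_form_toMatrix_eq_trIP` (the `wB`-weighted flat form of `toMatrix B′ B′ Φ` at coordinates `v` IS NODE 00's `trIP (wB i) g (Φ g)`),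
  `weighted_normSq_eq_trIP` (`Σ_p wB(p.1)‖v p‖² = trIP (wB i) g g`), ★★ `weightedAccretive_toMatrix_XY_parSymY` — the matrix of `X(U₀)` is
  `(4(d+1)+1)⁻²`-accretive in the `wB`-weighted pairing at EVERY `G`-valued `U₀`, `G ≤ U(N)` (n06-w1's `trIP_XY_parSymY_ge`, by name).
* §3 ★★★ `norm_toMatrix_XinvY_parSymY_le_of_unitary` — `IsUnit (X(U₀))` (dag-n06's `isUnit_XY_parSymY`) ∧ `‖toMatrix B′ B′ (X(U₀)⁻¹) p q‖ ≤
  Θ·(4(4(d+1)+1)²)·e^{−κ d₁(loc p, loc q)}` for every rate `0 ≤ κ ≤ κ₀∕4` with `8(Θa)κc_V ≤ (4(d+1)+1)⁻²κ₀`, DISPLAYING ONLY: the entry decay `(a, κ₀)` of `X(U₀)`'s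
  matrix through a location map `loc` (the X-station's output at the centre), the block-volume ratio numeral `Θ` (`√wB s ≤ Θ·√wB t`), the half-rate volume numeral
  `c_V` of `loc`.  This is EXACTLY input `hG` of `B13InverseOperatorCoordinates.rawEntryLetters_toMatrix_ringInverse_located` for the X⁻¹-junction at v4.
* §4 `halfRate_rowSum_le_of_fibre` ∕ `halfRate_colSum_le_of_fibre` (the volume numeral `c_V = m·c₀(1,κ₀∕2)^ν` from a fibre bound `m` of `loc`, every torus),
  ★★★ `norm_toMatrix_XinvY_parSymY_le_of_unitary_fibre` (§3 with `c_V` discharged: displayed `(a, κ₀)`, `Θ`, `m` only).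
HONEST FRAMING: a composition; the positivity is n06-w1's theorem (its scope: the genuine `Q′G′²Q′*` at def-Y's v4 letters, every unitary background), the decay
of `X(U₀)` stays DISPLAYED (it is the X-station's, fed by 79 on the (3.35) class), the Combes–Thomas step is module 80 over the tree's almost-local engine; print's
(3.48) rate `δ₀d(y,y′)` is NOT claimed — the rate here is whatever `(a, κ₀, c_V, Θ)` allow; nothing of Bałaban's asserted beyond the cited theorems; N06 ∕ N10 NOT
discharged; K1⁷ NOT closed; counts unmoved (typed 28∕28 · discharged 5∕27); 0 `def`, 0 `sorry`, standard axioms; one finite 𝕋⁴ programme at fixed ε — R4 closes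
the conditional finite-𝕋⁴ rung `BalabanLadder.UV` only; the YM mass gap (Clay) is NOT proved by any of this; nothing continuum ∕ ℝ⁴ ∕ OS.

References: T. Bałaban, CMP 99 (1985) 389–434 [Balaban1985BackgroundPropagators] (3.25) p.394, Thm 3.2 (3.48) p.398, Thm 3.11 p.416, (3.66)–(3.70) pp.403–404, Thm 3.10
(3.107)–(3.108) pp.415–416; CMP 96 (1984) 223–250 [Balaban1984PropagatorsII] Lemma 2.1 (2.61) p.234, Prop 2.3 p.238; CMP 116 (1988) 1–22 [Balaban1988RG2Cluster]
(2.5)–(2.7) pp.12–13, p.15; M. Aizenman, S. Warzel, *Random Operators* (AMS 2015) §10.3 [AizenmanWarzel2015].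
-/

noncomputable section

namespace Literature.MathematicalPhysics.QuantumFieldTheory.Balaban1983to89.B13XinvCentreDecayOfUnitary

open Finset
open scoped Matrix Matrix.Norms.L2Operator ComplexConjugate
open Literature.MathematicalPhysics.QuantumFieldTheory.Balaban1983to89
open Node00 B6KLevelCensusIndexV1
open Literature.MathematicalPhysics.QuantumFieldTheory.Balaban1983to89.B9Thm37GlueTorus (tdist1 tdist1_self tdist1_comm tdist1_triangle tdist1_nonneg)
open Literature.MathematicalPhysics.QuantumFieldTheory.Balaban1983to89.B5TorusCover (UT)
open Literature.MathematicalPhysics.QuantumFieldTheory.Balaban1983to89.B9Thm311ReadingCoords (trIP)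
open Literature.MathematicalPhysics.QuantumFieldTheory.Balaban1983to89.B9Thm311ReadingAtLetters (wB wB_pos)
open Literature.MathematicalPhysics.QuantumFieldTheory.Balaban1983to89.B9Thm311PosAtRecordV4 (isUnit_XY_parSymY)
open Literature.MathematicalPhysics.QuantumFieldTheory.Balaban1983to89.B9Thm32SiteXBoundsY (trIP_XY_parSymY_ge)
open Literature.MathematicalPhysics.QuantumFieldTheory.Balaban1983to89.B13InverseOperatorCoordinates (piProdBasis_repr toMatrix_ringInverse)
open Literature.MathematicalPhysics.QuantumFieldTheory.Balaban1983to89.B13MatrixUnitBasisNumerals (stdBasis_repr_apply)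
open Literature.MathematicalPhysics.QuantumFieldTheory.Balaban1983to89.B13InverseDecayWeightedPairing (inverse_decay_of_expDecay_weighted)

variable {d ℓ : ℕ} {hd : 1 ≤ d + 1} {hL : Odd (ℓ + 1) ∧ 1 < ℓ + 1} {b₀ b₁ : ℝ}
variable (i : KIdx d ℓ hd hL b₀ b₁) {N : ℕ} [DecidableEq (BlkY i)]

/-! ## §1. The product basis `δ_s ⊗ E_{ab}` of the block sector: coordinates are entries -/

section Dictionary

omit [DecidableEq (BlkY i)] in
/-- the `B′`-coordinates of a block field are its matrix entries: `B′.repr g (s,(a,b)) = g s a b`. [folklore] [cite: Balaban1985BackgroundPropagators, (3.25) p.394, dictionary] -/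
theorem repr_piStd_apply (g : BlkY i → Matrix (Fin N) (Fin N) ℂ) (p : BlkY i × (Fin N × Fin N)) :
    ((Pi.basis fun _ : BlkY i => Matrix.stdBasis ℂ (Fin N) (Fin N)).reindex (Equiv.sigmaEquivProd (BlkY i) (Fin N × Fin N))).repr g p =
      g p.1 p.2.1 p.2.2 := by
  obtain ⟨s, a, b⟩ := p
  rw [piProdBasis_repr, stdBasis_repr_apply]

omit [DecidableEq (BlkY i)] in
/-- the block field with prescribed coordinates `v`: `g s a b := v (s,(a,b))` has `B′.repr g = v`. [folklore] [cite: Balaban1985BackgroundPropagators, (3.25) p.394, dictionary] -/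
theorem coe_repr_piStd_of (v : BlkY i × (Fin N × Fin N) → ℂ) :
    ⇑(((Pi.basis fun _ : BlkY i => Matrix.stdBasis ℂ (Fin N) (Fin N)).reindex (Equiv.sigmaEquivProd (BlkY i) (Fin N × Fin N))).repr
        (fun s => Matrix.of fun a b => v (s, (a, b)))) = v := by
  funext p
  rw [repr_piStd_apply]
  rfl

/-- `Re(z̄ z) = |z|²`. [folklore] -/
private theorem re_star_mul_self (z : ℂ) : (star z * z).re = ‖z‖ ^ 2 := by
  rw [Complex.star_def, Complex.conj_mul', ← Complex.ofReal_pow, Complex.ofReal_re]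

end Dictionary

/-! ## §2. NODE 00's block-volume pairing `trIP (wB i)` IS the `wB`-weighted flat form of the product-basis matrix -/

section Pairing

/-- ★ **THE WEIGHTED FORM OF THE MATRIX IS `trIP`**: for `Φ : Module.End ℂ (BlkY i → M_N(ℂ))` and the block field `g` with coordinates `v`,
`Re Σ_p wB(p.1)·v̄_p·(toMatrix B′ B′ Φ · v)_p = trIP (wB i) g (Φ g)`. [cite: Balaban1985BackgroundPropagators, (3.25) p.394, p.393 (scalar products), dictionary] -/
theorem weighted_form_toMatrix_eq_trIP (Φ : Module.End ℂ (BlkY i → Matrix (Fin N) (Fin N) ℂ)) (v : BlkY i × (Fin N × Fin N) → ℂ) :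
    (∑ p, (wB i p.1 : ℂ) * (star (v p) *
        (LinearMap.toMatrix ((Pi.basis fun _ : BlkY i => Matrix.stdBasis ℂ (Fin N) (Fin N)).reindex (Equiv.sigmaEquivProd (BlkY i) (Fin N × Fin N)))
          ((Pi.basis fun _ : BlkY i => Matrix.stdBasis ℂ (Fin N) (Fin N)).reindex (Equiv.sigmaEquivProd (BlkY i) (Fin N × Fin N))) Φ *ᵥ v) p)).re =
      trIP (wB i) (fun s => Matrix.of fun a b => v (s, (a, b))) (Φ (fun s => Matrix.of fun a b => v (s, (a, b)))) := by
  set g : BlkY i → Matrix (Fin N) (Fin N) ℂ := fun s => Matrix.of fun a b => v (s, (a, b)) with hg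
  have hv : v = ⇑(((Pi.basis fun _ : BlkY i => Matrix.stdBasis ℂ (Fin N) (Fin N)).reindex (Equiv.sigmaEquivProd (BlkY i) (Fin N × Fin N))).repr g) :=
    (coe_repr_piStd_of i v).symm
  rw [hv, LinearMap.toMatrix_mulVec_repr, trIP, Complex.re_sum, Fintype.sum_prod_type]
  refine Finset.sum_congr rfl fun s _ => ?_
  rw [Fintype.sum_prod_type]
  simp only [repr_piStd_apply, Complex.re_ofReal_mul, ← Finset.mul_sum]

omit [DecidableEq (BlkY i)] in
/-- … and the weighted norm square of the coordinates is `trIP (wB i) g g`. [cite: Balaban1985BackgroundPropagators, (3.25) p.394, dictionary] -/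
theorem weighted_normSq_eq_trIP (v : BlkY i × (Fin N × Fin N) → ℂ) :
    ∑ p, wB i p.1 * ‖v p‖ ^ 2 = trIP (wB i) (fun s => Matrix.of fun a b => v (s, (a, b))) (fun s => Matrix.of fun a b => v (s, (a, b))) := by
  rw [trIP, Fintype.sum_prod_type]
  refine Finset.sum_congr rfl fun s _ => ?_
  rw [Fintype.sum_prod_type]
  simp only [Matrix.of_apply, re_star_mul_self, ← Finset.mul_sum]

variable {G : Subgroup (Matrix (Fin N) (Fin N) ℂ)ˣ}

/-- ★★ **THE MATRIX OF `X(U₀) = (Q′G′²Q′*)(U₀)` IS `(4(d+1)+1)⁻²`-ACCRETIVE IN THE `wB`-WEIGHTED PAIRING** at EVERY `G`-valued background, `G ≤ U(N)` — n06-w1's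
`trIP_XY_parSymY_ge` (Thm 3.2 ∕ Thm 3.11's third operator, quantitatively; no (3.35), no smallness) read through §2's dictionary.
[cite: Balaban1985BackgroundPropagators, (3.25) p.394, Thm 3.2 p.398, Thm 3.11 p.416; Balaban1984PropagatorsII, Prop 2.3 p.238] -/
theorem weightedAccretive_toMatrix_XY_parSymY (hG : G ≤ B7Prop2Explicit.unitaryUnits (Matrix (Fin N) (Fin N) ℂ))
    {U : CfgY (Matrix (Fin N) (Fin N) ℂ) i} (hU : ∀ μ x, U μ x ∈ G) (v : BlkY i × (Fin N × Fin N) → ℂ) :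
    ((4 * ((d : ℝ) + 1) + 1) ^ 2)⁻¹ * ∑ p, wB i p.1 * ‖v p‖ ^ 2 ≤
      (∑ p, (wB i p.1 : ℂ) * (star (v p) *
        (LinearMap.toMatrix ((Pi.basis fun _ : BlkY i => Matrix.stdBasis ℂ (Fin N) (Fin N)).reindex (Equiv.sigmaEquivProd (BlkY i) (Fin N × Fin N)))
          ((Pi.basis fun _ : BlkY i => Matrix.stdBasis ℂ (Fin N) (Fin N)).reindex (Equiv.sigmaEquivProd (BlkY i) (Fin N × Fin N)))
          (XY i (parSymY i) (GpY i (parSymY i)) U) *ᵥ v) p)).re := by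
  rw [weighted_normSq_eq_trIP, weighted_form_toMatrix_eq_trIP]
  exact trIP_XY_parSymY_ge i hG hU _

end Pairing

/-! ## §3. ★★★ The centre decay of `C(U₀) = X(U₀)⁻¹` at every unitary-valued background -/

section Centre

variable {G : Subgroup (Matrix (Fin N) (Fin N) ℂ)ˣ}
variable {ν : ℕ} {Nf : Fin ν → ℕ} [∀ j, NeZero (Nf j)]

/-- ★★★ **THE CENTRE DECAY OF PRINT's SECOND INVERSE, MODULO THE ENTRY DECAY OF THE UN-INVERTED OPERATOR.**  At EVERY `G`-valued background `U₀` (`G ≤ U(N)`):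
`X(U₀) = (Q′G′²Q′*)(U₀)` is invertible (dag-n06 `isUnit_XY_parSymY`) and, given the exponential entry decay `‖toMatrix B′ B′ (X(U₀)) p q‖ ≤ a·e^{−κ₀ d₁(loc p, loc q)}`
through a location map `loc` (DISPLAYED — the X-station's output at the centre), the block-volume ratio numeral `Θ` (`√wB s ≤ Θ·√wB t`) and the half-rate volume
numeral `c_V` of `loc`, the matrix of `C(U₀) = X(U₀)⁻¹` decays: `‖toMatrix B′ B′ (C(U₀)) p q‖ ≤ Θ·(4∕(4(d+1)+1)⁻²)·e^{−κ d₁(loc p, loc q)}` for every rate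
`0 ≤ κ ≤ κ₀∕4` with `8(Θa)κc_V ≤ (4(d+1)+1)⁻²κ₀` — positivity by n06-w1's theorem, Combes–Thomas by module 80.  EXACTLY input `hG` of
`B13InverseOperatorCoordinates.rawEntryLetters_toMatrix_ringInverse_located` for the X⁻¹-junction at v4.
[cite: Balaban1985BackgroundPropagators, (3.25) p.394, Thm 3.2 (3.48) p.398, Thm 3.11 p.416, (3.66)–(3.70) pp.403–404; Balaban1984PropagatorsII, Lemma 2.1 (2.61) p.234, Prop 2.3 p.238;
Balaban1988RG2Cluster, (2.5)–(2.7) pp.12–13; AizenmanWarzel2015, §10.3] -/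
theorem norm_toMatrix_XinvY_parSymY_le_of_unitary (hG : G ≤ B7Prop2Explicit.unitaryUnits (Matrix (Fin N) (Fin N) ℂ))
    {U₀ : CfgY (Matrix (Fin N) (Fin N) ℂ) i} (hU₀ : ∀ μ x, U₀ μ x ∈ G)
    (loc : BlkY i × (Fin N × Fin N) → UT Nf) {a κ₀ : ℝ} (ha : 0 ≤ a) (hκ₀ : 0 < κ₀)
    (hXdec : ∀ p q, ‖LinearMap.toMatrix
        ((Pi.basis fun _ : BlkY i => Matrix.stdBasis ℂ (Fin N) (Fin N)).reindex (Equiv.sigmaEquivProd (BlkY i) (Fin N × Fin N)))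
        ((Pi.basis fun _ : BlkY i => Matrix.stdBasis ℂ (Fin N) (Fin N)).reindex (Equiv.sigmaEquivProd (BlkY i) (Fin N × Fin N)))
        (XY i (parSymY i) (GpY i (parSymY i)) U₀) p q‖ ≤ a * Real.exp (-(κ₀ * tdist1 Nf (loc p) (loc q))))
    {Θ : ℝ} (hΘ : ∀ s t : BlkY i, Real.sqrt (wB i s) ≤ Θ * Real.sqrt (wB i t))
    {cV : ℝ} (hvol : ∀ p, ∑ q, Real.exp (-(κ₀ / 2 * tdist1 Nf (loc p) (loc q))) ≤ cV)
    (hvol' : ∀ q, ∑ p, Real.exp (-(κ₀ / 2 * tdist1 Nf (loc p) (loc q))) ≤ cV)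
    {κ : ℝ} (hκ : 0 ≤ κ) (hκ4 : κ ≤ κ₀ / 4) (hκm : 8 * (Θ * a) * κ * cV ≤ ((4 * ((d : ℝ) + 1) + 1) ^ 2)⁻¹ * κ₀) :
    IsUnit (XY i (parSymY i) (GpY i (parSymY i)) U₀) ∧
      ∀ p q, ‖LinearMap.toMatrix
          ((Pi.basis fun _ : BlkY i => Matrix.stdBasis ℂ (Fin N) (Fin N)).reindex (Equiv.sigmaEquivProd (BlkY i) (Fin N × Fin N)))
          ((Pi.basis fun _ : BlkY i => Matrix.stdBasis ℂ (Fin N) (Fin N)).reindex (Equiv.sigmaEquivProd (BlkY i) (Fin N × Fin N)))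
          (XinvY i (parSymY i) (GpY i (parSymY i)) U₀) p q‖ ≤
        Θ * (4 / ((4 * ((d : ℝ) + 1) + 1) ^ 2)⁻¹) * Real.exp (-(κ * tdist1 Nf (loc p) (loc q))) := by
  refine ⟨isUnit_XY_parSymY i hG hU₀, fun p q => ?_⟩
  have hm : (0 : ℝ) < ((4 * ((d : ℝ) + 1) + 1) ^ 2)⁻¹ := by positivity
  have h80 := inverse_decay_of_expDecay_weighted (fun p q : BlkY i × (Fin N × Fin N) => tdist1 Nf (loc p) (loc q))
    (fun p => tdist1_self (loc p)) (fun p q => tdist1_comm (loc p) (loc q)) (fun p q r => tdist1_triangle (loc p) (loc q) (loc r))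
    (fun p q => tdist1_nonneg (loc p) (loc q)) (fun p : BlkY i × (Fin N × Fin N) => wB i p.1) (fun p => wB_pos i p.1)
    (fun p q => hΘ p.1 q.1)
    (LinearMap.toMatrix
        ((Pi.basis fun _ : BlkY i => Matrix.stdBasis ℂ (Fin N) (Fin N)).reindex (Equiv.sigmaEquivProd (BlkY i) (Fin N × Fin N)))
        ((Pi.basis fun _ : BlkY i => Matrix.stdBasis ℂ (Fin N) (Fin N)).reindex (Equiv.sigmaEquivProd (BlkY i) (Fin N × Fin N)))
        (XY i (parSymY i) (GpY i (parSymY i)) U₀))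
    hm ha hκ₀ hκ hκ4 hκm (weightedAccretive_toMatrix_XY_parSymY i hG hU₀) hXdec hvol hvol'
  have e : LinearMap.toMatrix
        ((Pi.basis fun _ : BlkY i => Matrix.stdBasis ℂ (Fin N) (Fin N)).reindex (Equiv.sigmaEquivProd (BlkY i) (Fin N × Fin N)))
        ((Pi.basis fun _ : BlkY i => Matrix.stdBasis ℂ (Fin N) (Fin N)).reindex (Equiv.sigmaEquivProd (BlkY i) (Fin N × Fin N)))
        (XinvY i (parSymY i) (GpY i (parSymY i)) U₀) =
      (LinearMap.toMatrix
        ((Pi.basis fun _ : BlkY i => Matrix.stdBasis ℂ (Fin N) (Fin N)).reindex (Equiv.sigmaEquivProd (BlkY i) (Fin N × Fin N)))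
        ((Pi.basis fun _ : BlkY i => Matrix.stdBasis ℂ (Fin N) (Fin N)).reindex (Equiv.sigmaEquivProd (BlkY i) (Fin N × Fin N)))
        (XY i (parSymY i) (GpY i (parSymY i)) U₀))⁻¹ :=
    toMatrix_ringInverse _ _
  rw [e]
  exact h80.2 p q

end Centre

/-! ## §4. The volume numeral discharged by a fibre bound of the location map (every torus) -/

section Volume

variable {ν : ℕ} {Nf : Fin ν → ℕ} [∀ j, NeZero (Nf j)]

omit [DecidableEq (BlkY i)] in
/-- the half-rate ROW volume sum through a location map with fibre bound `m`: `Σ_q e^{−(κ₀∕2)d₁(loc p, loc q)} ≤ m·c₀(1,κ₀∕2)^ν` on every torus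
(`B13EntryLetterAlgebra.sum_fiber_le` + `B13LocalKernelWalks.rowSum_torus`). [cite: Balaban1984PropagatorsII, Lemma 2.1 (2.61) p.234, (2.52) p.232] -/
theorem halfRate_rowSum_le_of_fibre {X : Type} [Fintype X] (loc : X → UT Nf) {m : ℕ}
    (hfib : ∀ y : UT Nf, (univ.filter fun k => loc k = y).card ≤ m) {κ₀ : ℝ} (hκ₀ : 0 < κ₀) (p : X) :
    ∑ q, Real.exp (-(κ₀ / 2 * tdist1 Nf (loc p) (loc q))) ≤ m * B6.c0 1 (κ₀ / 2) ^ ν := by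
  have hrow : ∑ z : UT Nf, Real.exp (-(κ₀ / 2 * tdist1 Nf (loc p) z)) ≤ B6.c0 1 (κ₀ / 2) ^ ν :=
    B13LocalKernelWalks.rowSum_torus Nf (half_pos hκ₀) (loc p)
  exact (B13EntryLetterAlgebra.sum_fiber_le hfib (f := fun y => Real.exp (-(κ₀ / 2 * tdist1 Nf (loc p) y))) fun _ => Real.exp_nonneg _).trans
    (mul_le_mul_of_nonneg_left hrow (Nat.cast_nonneg _))

omit [DecidableEq (BlkY i)] in
/-- … and the COLUMN sum (symmetry of `d₁`). [cite: Balaban1984PropagatorsII, Lemma 2.1 (2.61) p.234] -/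
theorem halfRate_colSum_le_of_fibre {X : Type} [Fintype X] (loc : X → UT Nf) {m : ℕ}
    (hfib : ∀ y : UT Nf, (univ.filter fun k => loc k = y).card ≤ m) {κ₀ : ℝ} (hκ₀ : 0 < κ₀) (q : X) :
    ∑ p, Real.exp (-(κ₀ / 2 * tdist1 Nf (loc p) (loc q))) ≤ m * B6.c0 1 (κ₀ / 2) ^ ν := by
  refine le_trans (le_of_eq (Finset.sum_congr rfl fun p _ => by rw [tdist1_comm])) (halfRate_rowSum_le_of_fibre loc hfib hκ₀ q)

variable {G : Subgroup (Matrix (Fin N) (Fin N) ℂ)ˣ}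

/-- ★★★ **THE CENTRE DECAY WITH THE VOLUME NUMERAL DISCHARGED** by the fibre bound `m` of `loc` (`c_V = m·c₀(1,κ₀∕2)^ν`): the junction's binder set
(`hU`, `hG`, `hfib`) in one call. [cite: Balaban1985BackgroundPropagators, (3.25) p.394, Thm 3.2 (3.48) p.398, Thm 3.11 p.416; Balaban1984PropagatorsII, Lemma 2.1 (2.61) p.234;
Balaban1988RG2Cluster, (2.5)–(2.7) pp.12–13; AizenmanWarzel2015, §10.3] -/
theorem norm_toMatrix_XinvY_parSymY_le_of_unitary_fibre (hG : G ≤ B7Prop2Explicit.unitaryUnits (Matrix (Fin N) (Fin N) ℂ))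
    {U₀ : CfgY (Matrix (Fin N) (Fin N) ℂ) i} (hU₀ : ∀ μ x, U₀ μ x ∈ G)
    (loc : BlkY i × (Fin N × Fin N) → UT Nf) {m : ℕ} (hfib : ∀ y : UT Nf, (univ.filter fun k => loc k = y).card ≤ m)
    {a κ₀ : ℝ} (ha : 0 ≤ a) (hκ₀ : 0 < κ₀)
    (hXdec : ∀ p q, ‖LinearMap.toMatrix
        ((Pi.basis fun _ : BlkY i => Matrix.stdBasis ℂ (Fin N) (Fin N)).reindex (Equiv.sigmaEquivProd (BlkY i) (Fin N × Fin N)))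
        ((Pi.basis fun _ : BlkY i => Matrix.stdBasis ℂ (Fin N) (Fin N)).reindex (Equiv.sigmaEquivProd (BlkY i) (Fin N × Fin N)))
        (XY i (parSymY i) (GpY i (parSymY i)) U₀) p q‖ ≤ a * Real.exp (-(κ₀ * tdist1 Nf (loc p) (loc q))))
    {Θ : ℝ} (hΘ : ∀ s t : BlkY i, Real.sqrt (wB i s) ≤ Θ * Real.sqrt (wB i t))
    {κ : ℝ} (hκ : 0 ≤ κ) (hκ4 : κ ≤ κ₀ / 4)
    (hκm : 8 * (Θ * a) * κ * (m * B6.c0 1 (κ₀ / 2) ^ ν) ≤ ((4 * ((d : ℝ) + 1) + 1) ^ 2)⁻¹ * κ₀) :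
    IsUnit (XY i (parSymY i) (GpY i (parSymY i)) U₀) ∧
      ∀ p q, ‖LinearMap.toMatrix
          ((Pi.basis fun _ : BlkY i => Matrix.stdBasis ℂ (Fin N) (Fin N)).reindex (Equiv.sigmaEquivProd (BlkY i) (Fin N × Fin N)))
          ((Pi.basis fun _ : BlkY i => Matrix.stdBasis ℂ (Fin N) (Fin N)).reindex (Equiv.sigmaEquivProd (BlkY i) (Fin N × Fin N)))
          (XinvY i (parSymY i) (GpY i (parSymY i)) U₀) p q‖ ≤
        Θ * (4 / ((4 * ((d : ℝ) + 1) + 1) ^ 2)⁻¹) * Real.exp (-(κ * tdist1 Nf (loc p) (loc q))) :=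
  norm_toMatrix_XinvY_parSymY_le_of_unitary i hG hU₀ loc ha hκ₀ hXdec hΘ (halfRate_rowSum_le_of_fibre loc hfib hκ₀)
    (halfRate_colSum_le_of_fibre loc hfib hκ₀) hκ hκ4 hκm

end Volume

end Literature.MathematicalPhysics.QuantumFieldTheory.Balaban1983to89.B13XinvCentreDecayOfUnitary

end
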